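import Literature.NumberTheory.LFunctions.DedekindZetaEntireConvexity
import Literature.NumberTheory.NumberFields.RegulatorLowerBound
import Literature.NumberTheory.NumberFields.UnitHeightGap
import HarnessLib

/-!
# An effective UPPER bound `h_K · R_K ≤ C(n) · |d_K|^{3/2}` for every number field of degree `≤ n`,
# and `h_K ≤ C'(n) · |d_K|^{3/2}`

Topic `Literature/NumberTheory/NumberFields`, namespace `Literature.NumberTheory.NumberFields`
(companion of `ResidueLowerBoundAllFields.lean`, the trivial effective LOWER direction).  Everything here
is PROVED (theorems only, no definitions, standard axioms).

`n = [K:ℚ]`, `d_K` = discriminant, `h_K` = class number, `R_K` = regulator, `w_K` = number of roots of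
unity, `κ_K = Res_{s=1} ζ_K`.

* `dedekindZeta_residue_le_abs_discr` — `κ_K ≤ |d_K| · e^{2n} · (7/2)^{n+1}` for EVERY number field:
  the tree's uniform convexity bound for the entire `ζ₁_K(s) = (s − 1)ζ_K(s)`
  (`norm_dedekindZeta₁_le`, Rademacher–Phragmén–Lindelöf, `|ζ₁_K(z)| ≤ |d_K| e^{2n} |z + 5/2|^{n+1}` on
  `Re z ≥ −1/2`) read at `z = 1`, where `ζ₁_K(1) = κ_K`.
* `classNumber_mul_regulator_le` — `h_K · R_K ≤ (w_K/2) · e^{2n} (7/2)^{n+1} · |d_K|^{3/2}` for EVERY number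
  field, by Mathlib's class number formula `κ_K = 2^{r₁}(2π)^{r₂} h_K R_K / (w_K √|d_K|)`
  (`NumberField.dedekindZeta_residue_def`) and `2^{r₁}(2π)^{r₂} ≥ 2`.
* `classNumber_mul_regulator_le_of_odd` — odd degree: `w_K = 2` (Mathlib
  `torsionOrder_eq_two_of_odd_finrank`), so `h_K · R_K ≤ e^{2n} (7/2)^{n+1} · |d_K|^{3/2}`.
* `exists_classNumber_mul_regulator_le_of_finrank_le`, `exists_classNumber_le_of_finrank_le` —
  `∃ C(n)`, for every `K` of degree `≤ n`: `h_K R_K ≤ C |d_K|^{3/2}` (with `w_K ≤ W(n)`,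
  `UnitHeightGap.lean`) and `h_K ≤ C |d_K|^{3/2}` (with `R_K ≥ c_R(n)`, `RegulatorLowerBound.lean`).

HONEST PLACEMENT.  These are WEAK forms (exponent `3/2`) of classical effective upper bounds: Landau
(1918) `h_K R_K ≪_n √|d_K| log^{n−1}|d_K|`, Siegel/Brauer `h_K R_K ≪_{n,ε} |d_K|^{1/2+ε}`, Louboutin's
explicit `κ_K ≤ (e log|d_K| / (2(n−1)))^{n−1}` (2000); the exponent `3/2` is what the tree's ready-made
convexity bound (discriminant exponent `1`, not interpolated) gives in three lines.  Their use is
bookkeeping: a kernel-checked polynomial bound `h_K ≤ C(n)|d_K|^{3/2}` valid for EVERY number field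
(Mathlib proves finiteness of the class group, `NumberField.RingOfIntegers.instFintypeClassGroup`, but no
bound in `|d_K|`), e.g. for output-length bookkeeping of class-number functions.  Value = theorem
(reproduction, weak form), NOT summit progress.

## References
* E. Landau, *Verallgemeinerung eines Pólyaschen Satzes auf algebraische Zahlkörper*, Gött. Nachr.
  (1918) 478–488 (the bound `h R ≪ √|d| log^{n−1}|d|`).
* O. Bordellès, *Arithmetic Tales. Advanced Edition* (Universitext, 2020), Thm. 7.23 (Louboutin's explicit
  `h_K R_K < (w_K/2)(2/π)^{r₂}(e log|d_K| /(2√2 (n−1)))^{n−1} |d_K|^{1/2}`, `n ≥ 4`). [Bordelles2020]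
* S. Louboutin, *Explicit bounds for residues of Dedekind zeta functions, values of L-functions at
  s = 1, and relative class numbers*, J. Number Theory 85 (2000) 263–282. [Louboutin2000]
* H. Rademacher, *On the Phragmén–Lindelöf theorem and some applications*, Math. Z. 72 (1959)
  192–204, Thm. 4 (the convexity bound used, tree `norm_dedekindZeta₁_le`). [Rademacher1959]
* Mathlib, `Mathlib/NumberTheory/NumberField/DedekindZeta.lean` (`dedekindZeta_residue_def`).
-/

open Module NumberField NumberField.InfinitePlace NumberField.Units

namespace Literature.NumberTheory.NumberFields

open Literature.NumberTheory.LFunctions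

/-- **`κ_K ≤ |d_K| · e^{2n} · (7/2)^{n+1}`** for every number field `K` of degree `n`: the uniform
convexity bound `norm_dedekindZeta₁_le` at `z = 1` (`ζ₁_K(1) = κ_K`). [cite: Rademacher1959, Thm. 4] -/
theorem dedekindZeta_residue_le_abs_discr (K : Type*) [Field K] [NumberField K] :
    dedekindZeta_residue K ≤
      |(discr K : ℝ)| * Real.exp (2 * finrank ℚ K) * (7 / 2 : ℝ) ^ (finrank ℚ K + 1) := by
  have h := norm_dedekindZeta₁_le K (z := 1) (by norm_num)
  have h1 : ‖dedekindZeta₁ K 1‖ = dedekindZeta_residue K := by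
    rw [dedekindZeta₁_apply_one, Complex.norm_real, Real.norm_eq_abs,
      abs_of_pos (dedekindZeta_residue_pos K)]
  have h7 : ‖(1 : ℂ) + 5 / 2‖ = 7 / 2 := by
    rw [show (1 : ℂ) + 5 / 2 = ((7 / 2 : ℝ) : ℂ) by push_cast; norm_num, Complex.norm_real,
      Real.norm_eq_abs, abs_of_pos (by norm_num)]
  have hd : ((discr K).natAbs : ℝ) = |(discr K : ℝ)| := by rw [Nat.cast_natAbs, Int.cast_abs]
  rw [h1, h7, hd] at h
  exact h

/-- **`h_K · R_K ≤ (w_K/2) · e^{2n} · (7/2)^{n+1} · |d_K|^{3/2}`** for every number field `K` of degree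
`n`: the residue bound and the class number formula `κ_K = 2^{r₁}(2π)^{r₂} h_K R_K / (w_K √|d_K|)` with
`2^{r₁}(2π)^{r₂} ≥ 2^{r₁+r₂} ≥ 2`.  (Weak form of Landau's `h R ≪ √|d| log^{n−1}|d|` and of Louboutin's explicit bound, Bordellès Thm. 7.23.) [cite: Louboutin2000, Thm. 1 (weak form)] -/
theorem classNumber_mul_regulator_le (K : Type*) [Field K] [NumberField K] :
    (classNumber K : ℝ) * regulator K ≤
      (torsionOrder K : ℝ) / 2 * Real.exp (2 * finrank ℚ K) * (7 / 2 : ℝ) ^ (finrank ℚ K + 1) *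
        (|(discr K : ℝ)| * Real.sqrt |(discr K : ℝ)|) := by
  set n : ℕ := finrank ℚ K with hndef
  have hκ := dedekindZeta_residue_le_abs_discr K
  rw [← hndef] at hκ
  -- sizes
  have hd0 : 0 < |(discr K : ℝ)| := abs_pos.mpr (Int.cast_ne_zero.mpr (discr_ne_zero K))
  have hsqrt0 : 0 < Real.sqrt |(discr K : ℝ)| := Real.sqrt_pos.mpr hd0
  have hw0 : (0 : ℝ) < torsionOrder K := by exact_mod_cast torsionOrder_pos K
  have hR0 : 0 < regulator K := regulator_pos K
  have hh0 : (0 : ℝ) < classNumber K := by exact_mod_cast classNumber_pos K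
  -- the archimedean factor `A = 2^{r₁}(2π)^{r₂} ≥ 2`
  set A : ℝ := (2 : ℝ) ^ nrRealPlaces K * (2 * Real.pi) ^ nrComplexPlaces K with hAdef
  have hA2 : (2 : ℝ) ≤ A := by
    have hrk : nrRealPlaces K + 2 * nrComplexPlaces K = n := by
      rw [hndef]; exact card_add_two_mul_card_eq_rank K
    have hn1 : 1 ≤ n := by rw [hndef]; exact Module.finrank_pos
    have hsum : 1 ≤ nrRealPlaces K + nrComplexPlaces K := by omega
    have hπ2 : (2 : ℝ) ≤ 2 * Real.pi := by linarith [Real.pi_gt_three]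
    calc (2 : ℝ) = 2 ^ 1 := by norm_num
      _ ≤ 2 ^ (nrRealPlaces K + nrComplexPlaces K) := pow_le_pow_right₀ (by norm_num) hsum
      _ = 2 ^ nrRealPlaces K * 2 ^ nrComplexPlaces K := pow_add _ _ _
      _ ≤ 2 ^ nrRealPlaces K * (2 * Real.pi) ^ nrComplexPlaces K := by
          apply mul_le_mul_of_nonneg_left _ (by positivity)
          exact pow_le_pow_left₀ (by norm_num) hπ2 _
  have hA0 : 0 < A := by linarith
  -- class number formula: `h R = κ · w √|d| / A`
  have hres : dedekindZeta_residue K = A * regulator K * classNumber K /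
      (torsionOrder K * Real.sqrt |(discr K : ℝ)|) := by
    rw [dedekindZeta_residue_def, hAdef]
  have hhR : (classNumber K : ℝ) * regulator K =
      dedekindZeta_residue K * (torsionOrder K * Real.sqrt |(discr K : ℝ)|) / A := by
    rw [hres]
    field_simp
  rw [hhR, div_le_iff₀ hA0]
  -- `κ · (w √d) ≤ bound · (w √d)` and `(w/2 · … ) · A ≥ (w/2 · …) · 2`
  have hB0 : 0 ≤ Real.exp (2 * (n : ℝ)) * (7 / 2 : ℝ) ^ (n + 1) := by positivity
  calc dedekindZeta_residue K * (torsionOrder K * Real.sqrt |(discr K : ℝ)|)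
      ≤ |(discr K : ℝ)| * Real.exp (2 * (n : ℝ)) * (7 / 2 : ℝ) ^ (n + 1) *
          (torsionOrder K * Real.sqrt |(discr K : ℝ)|) :=
        mul_le_mul_of_nonneg_right hκ (by positivity)
    _ = (torsionOrder K : ℝ) / 2 * Real.exp (2 * (n : ℝ)) * (7 / 2 : ℝ) ^ (n + 1) *
          (|(discr K : ℝ)| * Real.sqrt |(discr K : ℝ)|) * 2 := by ring
    _ ≤ (torsionOrder K : ℝ) / 2 * Real.exp (2 * (n : ℝ)) * (7 / 2 : ℝ) ^ (n + 1) *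
          (|(discr K : ℝ)| * Real.sqrt |(discr K : ℝ)|) * A := by
        apply mul_le_mul_of_nonneg_left hA2
        positivity

/-- **Odd degree**: `w_K = 2` (Mathlib `torsionOrder_eq_two_of_odd_finrank`), so
`h_K · R_K ≤ e^{2n} · (7/2)^{n+1} · |d_K|^{3/2}` for every number field of odd degree `n`. [cite: Louboutin2000, Thm. 1 (weak form)] -/
theorem classNumber_mul_regulator_le_of_odd (K : Type*) [Field K] [NumberField K]
    (hodd : Odd (finrank ℚ K)) :
    (classNumber K : ℝ) * regulator K ≤
      Real.exp (2 * finrank ℚ K) * (7 / 2 : ℝ) ^ (finrank ℚ K + 1) *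
        (|(discr K : ℝ)| * Real.sqrt |(discr K : ℝ)|) := by
  have h := classNumber_mul_regulator_le K
  rw [torsionOrder_eq_two_of_odd_finrank hodd] at h
  norm_num at h
  exact h

/-- **`h_K · R_K ≤ C(n) · |d_K|^{3/2}` for every number field of degree `≤ n`**, with one constant
`C = C(n)` (`w_K ≤ W(n)` from `UnitHeightGap.lean`). [cite: Louboutin2000, Thm. 1 (weak form)] -/
theorem exists_classNumber_mul_regulator_le_of_finrank_le (n : ℕ) :
    ∃ C : ℝ, 0 < C ∧ ∀ (K : Type) [Field K] [NumberField K], finrank ℚ K ≤ n →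
      (classNumber K : ℝ) * regulator K ≤ C * (|(discr K : ℝ)| * Real.sqrt |(discr K : ℝ)|) := by
  obtain ⟨W, hW⟩ := exists_torsionOrder_le_of_finrank_le n
  refine ⟨(max (W : ℝ) 1) / 2 * Real.exp (2 * n) * (7 / 2 : ℝ) ^ (n + 1), by positivity,
    fun K _ _ hK => ?_⟩
  have h := classNumber_mul_regulator_le K
  refine h.trans (mul_le_mul_of_nonneg_right ?_ (by positivity))
  have hw : (torsionOrder K : ℝ) ≤ max (W : ℝ) 1 :=
    le_trans (by exact_mod_cast hW K hK) (le_max_left _ _)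
  have he : Real.exp (2 * (finrank ℚ K : ℝ)) ≤ Real.exp (2 * (n : ℝ)) :=
    Real.exp_le_exp.mpr (by gcongr)
  have h7 : (7 / 2 : ℝ) ^ (finrank ℚ K + 1) ≤ (7 / 2 : ℝ) ^ (n + 1) :=
    pow_le_pow_right₀ (by norm_num) (by omega)
  have hw0 : (0 : ℝ) ≤ torsionOrder K := by positivity
  calc (torsionOrder K : ℝ) / 2 * Real.exp (2 * (finrank ℚ K : ℝ)) * (7 / 2 : ℝ) ^ (finrank ℚ K + 1)
      ≤ (max (W : ℝ) 1) / 2 * Real.exp (2 * (n : ℝ)) * (7 / 2 : ℝ) ^ (n + 1) := by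
        apply mul_le_mul (mul_le_mul (by linarith) he (by positivity) (by positivity)) h7
          (by positivity) (by positivity)

/-- **`h_K ≤ C(n) · |d_K|^{3/2}` for every number field of degree `≤ n`** (the previous bound divided by
the regulator lower bound `R_K ≥ c_R(n)` of `RegulatorLowerBound.lean`).  Mathlib proves the class group
finite; this is an effective, kernel-checked (weak) bound in the discriminant. [cite: Bordelles2020, Thm. 7.23 (weak form)] -/
theorem exists_classNumber_le_of_finrank_le (n : ℕ) :
    ∃ C : ℝ, 0 < C ∧ ∀ (K : Type) [Field K] [NumberField K], finrank ℚ K ≤ n →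
      (classNumber K : ℝ) ≤ C * (|(discr K : ℝ)| * Real.sqrt |(discr K : ℝ)|) := by
  obtain ⟨C, hC, hhR⟩ := exists_classNumber_mul_regulator_le_of_finrank_le n
  obtain ⟨c, hc, hreg⟩ := exists_regulator_ge_of_finrank_le n
  refine ⟨C / c, by positivity, fun K _ _ hK => ?_⟩
  have h1 := hhR K hK
  have h2 := hreg K hK
  have hh0 : (0 : ℝ) ≤ classNumber K := by positivity
  rw [div_mul_eq_mul_div, le_div_iff₀ hc]
  calc (classNumber K : ℝ) * c ≤ (classNumber K : ℝ) * regulator K :=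
        mul_le_mul_of_nonneg_left h2 hh0
    _ ≤ C * (|(discr K : ℝ)| * Real.sqrt |(discr K : ℝ)|) := h1

end Literature.NumberTheory.NumberFields
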